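import Summits.CriticalPhenomena.PercolationContinuityZ3.Theorems.Transplant.FKConnectivityAllQAntipodalTwoSpinePhiType
import HarnessLib

/-!
# Connectivity correlation inequalities for `φ_{w,q}` — TWO-SPINE word model: the composite type READ OFF THE ROWS

Helper file (`--supports stmt-CriticalPhenomena-4575`), FK sub-lane `prim-bschramm-fk-2` (gen 15); builds on p205010 (kernel theorem,
internal audit signed; external expert review pending).  No named facts, no sorries, standard axioms.

Memo `bschramm/FROM-fk-2-g15-TWO-SPINE.md` §12 / blueprint L2: the link between `phiRun`'s composite types (`topComp`) and the row data used
by the cell signs (`rowC`, `rowCdot` of `…TwoSpineDefs` / `…TwoSpineCells`): `topComp r u = (lastFlag r.1 α, lastFlag r.2 ᾱ)`; for the deleted,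
present and absent roots this reads `(rowC α, rowC ᾱ)`, `(rowCdot α, rowC ᾱ)`, `(rowC α, rowCdot ᾱ)`.  Hence 'the side is of type 01' and
'`phiRun` makes it 10' (`topComp_phiRun`) translate into the loser/winner conditions of the Janus cells.
[cite: Grimmett2006, §3.8 (pp. 61–62); §3.9 (p. 63)]
-/

namespace Summit.CriticalPhenomena.PercolationContinuityZ3.Theorems

namespace FK

namespace TwoSpine

open X2Word

/-! ### The composite type read off the rows -/

/-- `lastFlag false = lastP` (= `rowC`). [folklore] -/
theorem lastFlag_false_eq_rowC (l : List Kind) : lastFlag false l = rowC l := by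
  unfold lastFlag rowC; split <;> simp_all [lastP]

/-- `lastFlag true = rowCdot` (conducting, or no object at all). [folklore] -/
theorem lastFlag_true_eq_rowCdot (l : List Kind) : lastFlag true l = rowCdot l := by
  unfold lastFlag rowCdot; split <;> simp_all

/-- **The composite type of the whole side is read off its two rows**: `topComp r u = (lastFlag r.1 α, lastFlag r.2 ᾱ)` — each row conducts
iff its outermost object is a particle, the root bit being the default for an empty row (gen 14's row semantics, word level). [folklore] -/
theorem topComp_eq_lastFlag (r : Bool × Bool) (u : List SLetter) :
    topComp r u = (lastFlag r.1 (sRowA u), lastFlag r.2 (sRowB u)) := by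
  induction u generalizing r with
  | nil => obtain ⟨r1, r2⟩ := r; simp [topComp, lastFlag]
  | cons l u ih =>
    rw [topComp_cons, ih, sRowA_cons, sRowB_cons]
    obtain ⟨r1, r2⟩ := r
    obtain ⟨k, b, bb⟩ := l
    cases k <;> cases b <;> cases bb <;> cases r1 <;> cases r2 <;> simp [compStep, sVisA, sVisB, lastFlag_cons]

/-- With the DELETED root `00` (Theorem U on `A∖y`) the composite is `(rowC α, rowC ᾱ)`. [folklore] -/
theorem topComp_deleted (u : List SLetter) : topComp (false, false) u = (rowC (sRowA u), rowC (sRowB u)) := by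
  rw [topComp_eq_lastFlag, lastFlag_false_eq_rowC, lastFlag_false_eq_rowC]

/-- With the PRESENT root `10` the composite is `(rowCdot α, rowC ᾱ)` (the marked edge in the `γ`-row). [folklore] -/
theorem topComp_present (u : List SLetter) : topComp (true, false) u = (rowCdot (sRowA u), rowC (sRowB u)) := by
  rw [topComp_eq_lastFlag, lastFlag_true_eq_rowCdot, lastFlag_false_eq_rowC]

/-- With the ABSENT root `01` the composite is `(rowC α, rowCdot ᾱ)` (the marked edge in the `γᶜ`-row). [folklore] -/
theorem topComp_absent (u : List SLetter) : topComp (false, true) u = (rowC (sRowA u), rowCdot (sRowB u)) := by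
  rw [topComp_eq_lastFlag, lastFlag_false_eq_rowC, lastFlag_true_eq_rowCdot]

end TwoSpine

end FK

end Summit.CriticalPhenomena.PercolationContinuityZ3.Theorems
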